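import Literature.IUT.HodgeArakelov.StableCurveAgreementOfCompletions
import Literature.IUT.HodgeArakelov.LabelClassesOfCuspsCor24ZHatAssembly
import Literature.IUT.HodgeTheaters.StableCurveTemperedDataOfSpecialFibreCor25
import Literature.IUT.HodgeTheaters.TemperedCoveringsCor23iiOfSpecialFibre
import HarnessLib

/-!
# [IUTchII] Cor 2.4 (i)′ at an agreement with the [IUTchI] §2 datum `ofSpecialFibre` of a tempered curve: `hΛ`, input (A), Cor 2.3 (ii) DISCHARGED

S. Mochizuki, *Inter-universal Teichmüller Theory II*, kurims manuscript (Dec. 2020), §2: Def 2.3 (i)(ii) pp. 67–68, Cor 2.4 (i) pp. 69–71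
(proof p. 70 l. −5 – p. 71 l. 5), Rmk 2.4.1 p. 71; *Inter-universal Teichmüller Theory I* (May 2020), §2: Cor 2.3 (ii)/(v) pp. 47–48,
Prop 2.4 (i) p. 50, Cor 2.5 p. 51 [cite: Mochizuki2012, II Cor 2.4 (i) pp.69–71; I §2 pp.46–51] (D-0012 claim key, status DISPUTED: every
[IUTchI]/[IUTchII] statement below is a HYPOTHESIS named by the tree's typed predicates or a kernel theorem about the tree's own constructions;
nothing printed is asserted); [SemiAnbd] §6 p. 71 [cite: MochizukiSemiAnbd2006, §6 p.71].

abc-iut cell, node **IUTchII:Cor2.4(i)** (CONE-BOARD claimant abc-iut-w4-d012; gen 6), GAP-LEDGER **G-w4d012-1** («what remains to instantiate is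
the agreement itself at the common model + hΛ», D-row 2026-08-26T00:33:22Z) — part 1 of 2 (part 2, `LabelClassesOfCuspsCor24iGenuine.lean`,
instantiates everything at abc-iut-L6-t19's tower of record `ofPiCHat` and the curve `X̲_v`, B15).  PROOF-ONLY (no `def`/`instance`/`structure`).
Consumed BY NAME: the proof of abc-iut-w5-d132's `StableCurveAgreement.exists_of_isProfiniteCompletion` (p430970, re-run with one more conjunct),
abc-iut-w5-d028's `CuspidalInertiaData.exists_model_of_agreementIso`, abc-iut-L6-t7's B13 `StableCurveAgreement` / `SubgraphDictionary` / `h23v`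
(p412701), abc-iut-L5-t11's `StableCurveTemperedData.ofSpecialFibre` with `ofSpecialFibre_nonempty_inertiaTpEquivZHat` («`I_x ≅ Ẑ(1)`») and
`cor23ii_ofSpecialFibre`, abc-iut-w5-d121's `StableCurveAgreement.hΛ_of_equiv_zHat` (p417096), and this lineage's own `inputA_of_prop24i` (p414109),
`cor24_i_of_inputs` (p411807), `cor24_i'_of_agreements` (p416675: ONE `ℍ`-dictionary PER `□`, finding F-w4d012-2).

WHAT IS PROVED, for ANY `±`-tower `W` (cuspidal datum `Cu` with the LEVEL CLAUSE of the transported datum, `[Π^±_v : Π_v] < ∞`) agreeing with the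
[IUTchI] §2 datum `ofSpecialFibre X d Sf …` of SOME tempered curve `X : TemperedCurve p` with special-fibre data:
* `StableCurveAgreement.exists_of_isProfiniteCompletion_isHomeomorph` — the B15 core (p430970) with `IsHomeomorph A.eHat` EXPOSED (the uniqueness
  isomorphism of the profinite completion is bicontinuous; the `ℍ`-dictionaries need it);
* `PlusMinusTower.hrel₂_of_levelClause` — conjunct 2 of Def 2.3 (ii)′ for `Π_v ⊆ Π^±_v` from the level clause + finite index;
* `StableCurveAgreement.hΛ_ofSpecialFibre` — the Rmk 2.4.1 datum `hΛ` of this lineage's closers is a THEOREM at such an agreement;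
* `StableCurveAgreement.inputA_ofSpecialFibre` — input (A) («`I^{γ'}_t ⊆ Π^±_v ⟹ γ' ∈ Δ^±_v`») modulo ONLY [IUTchI] Prop 2.4 (i) of the datum;
* `StableCurveAgreement.h23v_ofSpecialFibre` — input (C) («`Δ̂^±_{v□} ∩ Δ^±_v = Δ^±_{v□}`») for a `Π_{v□}` whose `Δ^±_{v□}` is carried by `eHat`
  onto `Δ^tp_{X,ℍ'}` for SOME sub-graph `Π^tp_{ℍ'} ≤ π₁^temp(G^c)` with `Π̂_{ℍ'}` its closure (print [IUTchI] p. 44), modulo ONLY [IUTchI] Cor 2.3 (v)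
  of that datum (Cor 2.3 (ii) being abc-iut-L5-t11's THEOREM there) — the datum's `Π^tp_X, Π̂_X, G_k`, cusps and `I_x` do not depend on `ℍ`, so
  the agreement RE-GRAPHS definitionally to every `ℍ'` with the same `Cu` and `eHat` (one datum PER `□`, F-w4d012-2, over ONE cuspidal datum);
* `cor24_i_ofSpecialFibre` / `cor24_i'_ofSpecialFibre` — the landed predicate `Cor24_i W Cu H I` / the decl of record `Cor24_i' Dec W Cu Ld I`
  from {`Prop24i`; per `□`: (`Π^tp_{ℍ'}`, `Π̂_{ℍ'}` = closure, Δ-dictionary identity, Cor 2.3 (v)); the open-subgroup step (B) `h23vi` = G-w4d012-2}.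

HONEST LABEL: kernel theorems about ANY agreement with a special-fibre datum (part 2 supplies the genuine one); G-w4d012-2 (B) is untouched
(its by-name reductions p419450/p420168/p420922 apply verbatim).  Typed ≠ proved for Prop 2.4 (i) / Cor 2.3 (v) themselves; nothing here
takes a side on [IUTchIII] Cor 3.12 or asserts anything of the series.
-/

noncomputable section

namespace Literature.IUT.HodgeArakelov

open Literature.AnabelianGeometry.EtaleTheta Literature.AnabelianGeometry.SemiGraphs Literature.IUT.HodgeTheaters
open scoped Pointwise

universe u

/-! ### §1. The B15 core with the bicontinuity of `eHat` exposed -/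

namespace PlusMinusTower

namespace StableCurveAgreement

variable {S : BadPlaceSetting.{u}} {P : TopGroup.{u}} {T : TemperedCoverings S P}

/-- **[IUTchII] Def 2.3 (i)(ii) — the agreement from a common profinite completion, WITH `eHat` A HOMEOMORPHISM** (abc-iut-w5-d132's
`exists_of_isProfiniteCompletion`, p430970, re-derived with one more conjunct): under the hypotheses of p430970 (`Π̂^±_v` a profinite
completion of `Π^±_v` through `emb`, `Π̂_X` one of `Π^tp_X` through `ιX`, `φ : Π^±_v ≃ₜ* Π^tp_X`, continuous augmentations compatible
through an injective continuous `σ`), there are abc-iut-w5-d028's transported cuspidal datum `Cu` and an agreement `A` whose `eHat` is the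
uniqueness isomorphism of the profinite completion — hence BICONTINUOUS (`IsHomeomorph A.eHat`, subspace topology on `Π̂^±_v ⊆ Π̂^cor_v`) —
with `eHat ∘ emb = ιX ∘ φ` and the level clause of `Cu`.  PROVED (same proof as p430970; the homeomorphism is
`IsProfiniteCompletion.nonempty_continuousMulEquiv`). ([IUTchII] Def 2.3 (i)(ii), kurims pp.67–68)
[claim: Mochizuki2012, status: disputed] -/
theorem exists_of_isProfiniteCompletion_isHomeomorph (W : PlusMinusTower T) (D : StableCurveTemperedData.{u})
    (embHat : T.Xplain →ₜ* W.pmHat) (hembHat : ∀ x, ((embHat x : W.pmHat) : W.Corhat) = W.emb x)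
    (hW : IsProfiniteCompletion embHat)
    (ιXHat : D.PiTp →ₜ* D.PiHat) (hιXHat : ∀ y, ιXHat y = D.ιX y) (hD : IsProfiniteCompletion ιXHat)
    (φ : T.Xplain ≃ₜ* D.PiTp)
    (haug : Continuous (W.aug.comp W.pmHat.subtype)) [T2Space D.Gk] (hpr : Continuous D.prHat)
    (σ : S.Gk →* D.Gk) (hσc : Continuous σ) (hσ : Function.Injective σ)
    (hcompat : ∀ x : T.Xplain, D.prTp (φ x) = σ (W.aug (W.emb x))) :
    ∃ Cu : CuspidalInertiaData W, ∃ A : StableCurveAgreement W Cu D,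
      IsHomeomorph A.eHat ∧
      (∀ x : T.Xplain, A.eHat (embHat x) = D.ιX (φ x)) ∧
      (∀ (Q I : Subgroup W.Corhat), Cu.IsCuspidalInertia Q I ↔
        I ≤ Q ∧ ∃ I₀ : Subgroup W.Corhat, Cu.IsCuspidalInertia W.piPM I₀ ∧ I = I₀ ⊓ Q) := by
  haveI := hW.compactSpace; haveI := hW.t2Space
  haveI := hD.t2Space
  -- `ιX ∘ φ : Π^±_v → Π̂_X` is a profinite completion (transport along the source isomorphism `φ`)
  let ιφ : T.Xplain →ₜ* D.PiHat := ιXHat.comp ⟨φ.toMulEquiv.toMonoidHom, φ.continuous⟩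
  have hιφ : IsProfiniteCompletion ιφ :=
    IsProfiniteCompletion.comp_continuousMulEquiv_source hD φ ιφ fun _ => rfl
  -- the uniqueness isomorphism of the profinite completion (a homeomorphism of topological groups)
  obtain ⟨e, he⟩ := IsProfiniteCompletion.nonempty_continuousMulEquiv hW hιφ
  have he' : ∀ x : T.Xplain, e (embHat x) = D.ιX (φ x) := fun x => by rw [he x]; exact hιXHat _
  -- `prHat ∘ e = σ ∘ aug` on `Π̂^±_v`: two continuous homomorphisms agreeing on the dense `Π^±_v`
  let lhs : W.pmHat →ₜ* D.Gk := ⟨D.prHat.comp e.toMulEquiv.toMonoidHom, hpr.comp e.continuous⟩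
  let rhs : W.pmHat →ₜ* D.Gk := ⟨σ.comp (W.aug.comp W.pmHat.subtype), hσc.comp haug⟩
  have hagree : lhs = rhs := hW.extension_unique lhs rhs fun x => by
    change D.prHat (e (embHat x)) = σ (W.aug ((embHat x : W.pmHat) : W.Corhat))
    rw [he', hembHat, ← hcompat, ← MonoidHom.comp_apply, D.prHat_comp]
  have hker : ∀ g : W.pmHat, (g : W.Corhat) ∈ W.aug.ker ↔ e g ∈ D.DeltaHat := by
    intro g
    have h1 : D.prHat (e g) = σ (W.aug (g : W.Corhat)) := by
      change lhs g = rhs g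
      rw [hagree]
    rw [MonoidHom.mem_ker, MonoidHom.mem_ker, h1]
    constructor
    · intro h; rw [h, map_one]
    · intro h; exact hσ (by rw [h, map_one])
  -- the cuspidal datum transported from `D` (abc-iut-w5-d028)
  obtain ⟨Cu, hCu, hlev⟩ := CuspidalInertiaData.exists_model_of_agreementIso W D e.toMulEquiv
  refine ⟨Cu, { eHat := e.toMulEquiv, map_piPM := ?_, mem_ker_iff := hker, inertia_iff := hCu },
    e.toHomeomorph.isHomeomorph, he', hlev⟩
  -- `Π^±_v ↦ ι(Π^tp_X)`: `e(embHat(Π^±_v)) = ιX(φ(Π^±_v)) = ιX(Π^tp_X)`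
  ext y
  constructor
  · rintro ⟨g, hg, rfl⟩
    rw [SetLike.mem_coe, Subgroup.mem_subgroupOf] at hg
    obtain ⟨x, hx⟩ := hg
    have hgx : g = embHat x := Subtype.ext (by rw [hembHat]; exact hx.symm)
    refine ⟨φ x, ?_⟩
    change D.ιX (φ x) = e g
    rw [hgx, he']
  · rintro ⟨z, rfl⟩
    refine ⟨embHat (φ.symm z), ?_, ?_⟩
    · rw [SetLike.mem_coe, Subgroup.mem_subgroupOf, hembHat]
      exact ⟨φ.symm z, rfl⟩
    · change e (embHat (φ.symm z)) = D.ιX z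
      rw [he', ContinuousMulEquiv.apply_symm_apply]

end StableCurveAgreement

/-! ### §2. Conjunct 2 of Def 2.3 (ii)′ for `Π_v ⊆ Π^±_v` from the level clause -/

variable {S : BadPlaceSetting.{u}} {P : TopGroup.{u}} {T : TemperedCoverings S P}

/-- **[IUTchII] Def 2.3 (ii), conjunct 2 for `Π_v ⊆ Π^±_v`** («the cuspidal inertia groups of `Π_⊆` [are] the intersections with
`Π_⊆` of those cuspidal inertia groups of `Π_⊇` that contain a finite index subgroup that lies inside `Π_⊆`», kurims p. 68) — the
hypothesis `hrel₂` of abc-iut-w5-d121's `hΛ_of_equiv_zHat` — for ANY tower whose `[Π^±_v : Π_v]` is finite (`hfi`) and ANY cuspidal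
datum with the LEVEL CLAUSE of abc-iut-w5-d028's transported datum («cuspidal for `Π` ⟺ `= I₀ ∩ Π` with `I₀` cuspidal for `Π^±_v`»):
`I₀ ∩ Π_v` has index `≤ [Π^±_v : Π_v]` in `I₀ ⊆ Π^±_v`.  PROVED. ([IUTchII] Def 2.3 (ii), kurims p.68) [claim: Mochizuki2012, status: disputed] -/
theorem hrel₂_of_levelClause (W : PlusMinusTower T) (hfi : (W.piV.subgroupOf W.piPM).index ≠ 0)
    (Cu : CuspidalInertiaData W)
    (hlev : ∀ (Q I : Subgroup W.Corhat), Cu.IsCuspidalInertia Q I ↔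
      I ≤ Q ∧ ∃ I₀ : Subgroup W.Corhat, Cu.IsCuspidalInertia W.piPM I₀ ∧ I = I₀ ⊓ Q) :
    ∀ I, Cu.IsCuspidalInertia W.piV I →
      ∃ I', Cu.IsCuspidalInertia W.piPM I' ∧ ((I' ⊓ W.piV).subgroupOf I').FiniteIndex ∧ I = I' ⊓ W.piV := by
  intro I hI
  obtain ⟨-, I₀, hI₀, rfl⟩ := (hlev _ I).mp hI
  refine ⟨I₀, hI₀, ⟨?_⟩, rfl⟩
  have hle : I₀ ≤ W.piPM := Cu.le_of_isCuspidalInertia hI₀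
  rw [Subgroup.inf_subgroupOf_left]
  change W.piV.relIndex I₀ ≠ 0
  exact fun h => hfi (Subgroup.relIndex_eq_zero_of_le_right hle h)

/-! ### §3. At the [IUTchI] §2 datum of a tempered curve with special-fibre data -/

namespace StableCurveAgreement

variable {S : BadPlaceSetting.{0}} {P : TopGroup.{0}} {T : TemperedCoverings S P} {W : PlusMinusTower T}
  {Cu : CuspidalInertiaData W}
  {p : ℕ} [Fact p.Prime] {X : TemperedCurve p} {d : X.GroupLevelData}
  {Sf : SpecialFibreData (X.toTemperedArithmeticGroup d)} {h36 : Sf.Gc.Prop36Hypotheses}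
  {Sigma SigmaHat : Set ℕ} {hsub : Sigma ⊆ SigmaHat} {hne : Sigma.Nonempty}
  {hprime : ∀ q ∈ SigmaHat, q.Prime} {hp : p ∉ Sigma} {TpH : Subgroup Sf.chart.G}
  {HatH : Subgroup (TemperedGraphGroupData.exists_completion_of_prop36 Sf.Gc h36 Sf.chart).choose}
  {hle : TpH.map (TemperedGraphGroupData.exists_completion_of_prop36 Sf.Gc h36
    Sf.chart).choose_spec.choose.toMonoidHom ≤ HatH}
  {cMH : {x : X.Pt // X.IsCusp x} → Prop}

/-- **[IUTchII] Rmk 2.4.1 (p. 71) / [IUTchI] Cor 2.5 (p. 51): the datum `hΛ` is a THEOREM at an agreement with a special-fibre datum.**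
For ANY tower `W` with `[Π^±_v : Π_v]` finite, ANY cuspidal datum `Cu` with the level clause, and ANY agreement `A` of `(W, Cu)` with the
[IUTchI] §2 datum of a tempered curve `X` with special-fibre data: every `Π_v`-cuspidal `I` contains, through `eHat`, a nontrivial compact
pro-`Σ` subgroup of `Δ^tp_X` — abc-iut-w5-d121's `hΛ_of_equiv_zHat` fed with `hrel₂_of_levelClause` and abc-iut-L5-t11's
`ofSpecialFibre_nonempty_inertiaTpEquivZHat` («`I_x ≅ Ẑ(1)`», the [SemiAnbd] §6 field read at the datum).  PROVED.
([IUTchII] Rmk 2.4.1, kurims p.71) [claim: Mochizuki2012, status: disputed] -/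
theorem hΛ_ofSpecialFibre (hfi : (W.piV.subgroupOf W.piPM).index ≠ 0)
    (hlev : ∀ (Q I : Subgroup W.Corhat), Cu.IsCuspidalInertia Q I ↔
      I ≤ Q ∧ ∃ I₀ : Subgroup W.Corhat, Cu.IsCuspidalInertia W.piPM I₀ ∧ I = I₀ ⊓ Q)
    (A : StableCurveAgreement W Cu
      (StableCurveTemperedData.ofSpecialFibre X d Sf h36 Sigma SigmaHat hsub hne hprime hp TpH HatH hle cMH))
    {I : Subgroup W.Corhat} (hI : Cu.IsCuspidalInertia W.piV I) :
    ∃ Λ : Subgroup (StableCurveTemperedData.ofSpecialFibre X d Sf h36 Sigma SigmaHat hsub hne hprime hp TpH HatH hle cMH).DeltaTp,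
      IsCompact (Λ : Set (StableCurveTemperedData.ofSpecialFibre X d Sf h36 Sigma SigmaHat hsub hne hprime hp TpH HatH hle cMH).DeltaTp) ∧
      Λ ≠ ⊥ ∧ IsProSigma (StableCurveTemperedData.ofSpecialFibre X d Sf h36 Sigma SigmaHat hsub hne hprime hp TpH HatH hle cMH).graph.Sigma Λ ∧
      (Λ.map (StableCurveTemperedData.ofSpecialFibre X d Sf h36 Sigma SigmaHat hsub hne hprime hp TpH HatH hle cMH).DeltaTp.subtype).map
          (StableCurveTemperedData.ofSpecialFibre X d Sf h36 Sigma SigmaHat hsub hne hprime hp TpH HatH hle cMH).ιX ≤ (I.subgroupOf W.pmHat).map A.eHat.toMonoidHom :=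
  A.hΛ_of_equiv_zHat (W.hrel₂_of_levelClause hfi Cu hlev)
    (fun x => (StableCurveTemperedData.ofSpecialFibre_nonempty_inertiaTpEquivZHat X d Sf h36 Sigma SigmaHat hsub hne
      hprime hp TpH HatH hle cMH x).some) I hI

/-- **Input (A) of the printed proof of [IUTchII] Cor 2.4 (i)** (p. 70 l. −4: «by [IUTchI], Corollary 2.5 …, the inclusion
`I^{γ'}_t ⊆ Π^±_{v□} ⊆ Π^±_v` implies that `γ' ∈ Δ^±_v`») at an agreement with a special-fibre datum, for a `Π_v`-cuspidal `I ⊆ Δ̂^cor_v`: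
MODULO ONLY [IUTchI] Prop 2.4 (i) of the datum (`Prop24i`, L5 node IUTchI:Prop2.4(i)) — `hΛ` being `hΛ_ofSpecialFibre`.  PROVED
(this lineage's `inputA_of_prop24i`, p414109). ([IUTchII] Cor 2.4 (i), kurims p.70) [claim: Mochizuki2012, status: disputed] -/
theorem inputA_ofSpecialFibre (hfi : (W.piV.subgroupOf W.piPM).index ≠ 0)
    (hlev : ∀ (Q I : Subgroup W.Corhat), Cu.IsCuspidalInertia Q I ↔
      I ≤ Q ∧ ∃ I₀ : Subgroup W.Corhat, Cu.IsCuspidalInertia W.piPM I₀ ∧ I = I₀ ⊓ Q)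
    (A : StableCurveAgreement W Cu
      (StableCurveTemperedData.ofSpecialFibre X d Sf h36 Sigma SigmaHat hsub hne hprime hp TpH HatH hle cMH))
    (h24i : (StableCurveTemperedData.ofSpecialFibre X d Sf h36 Sigma SigmaHat hsub hne hprime hp TpH HatH hle cMH).Prop24i)
    {I : Subgroup W.Corhat} (hI : Cu.IsCuspidalInertia W.piV I) (hIker : I ≤ W.aug.ker) :
    ∀ γ' : W.Corhat, γ' ∈ W.pmHat ⊓ W.aug.ker →
      I.map (MulAut.conj γ').toMonoidHom ≤ W.piPM → γ' ∈ W.piPM :=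
  A.inputA_of_prop24i h24i hIker (A.hΛ_ofSpecialFibre hfi hlev hI)

/-- **Input (C) of the printed proof of [IUTchII] Cor 2.4 (i)** (p. 71 l. 3–5: «`γ' ∈ Δ^±_{v□} = Δ̂^±_{v□} ∩ Δ^±_v` [cf. [IUTchI],
Corollary 2.3, (v)]») at an agreement with a special-fibre datum, for a subgroup `Π_{v□} ⊆ Π_v` whose `Δ^±_{v□}` is carried by `eHat`
onto `Δ^tp_{X,ℍ'}` for a sub-graph `Π^tp_{ℍ'} ≤ Π^tp_𝔾 = π₁^temp(G^c)` with `Π̂_{ℍ'}` the closure of `Π^tp_{ℍ'}` in `Π̂_𝔾` (`hH'`, print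
[IUTchI] p. 44; `hDic` the Δ-dictionary identity): MODULO ONLY [IUTchI] Cor 2.3 (v) of that datum (`h23v'`) — Cor 2.3 (ii) is
abc-iut-L5-t11's THEOREM `cor23ii_ofSpecialFibre` there, and the bicontinuity of `eHat` is an input (`hA`, supplied at the genuine pair
by `exists_of_isProfiniteCompletion_isHomeomorph`).  PROVED (abc-iut-L6-t7's `h23v`, p412701, over `exists_regraph`).
([IUTchII] Cor 2.4 (i), kurims p.71) [claim: Mochizuki2012, status: disputed] -/
theorem h23v_ofSpecialFibre
    (A : StableCurveAgreement W Cu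
      (StableCurveTemperedData.ofSpecialFibre X d Sf h36 Sigma SigmaHat hsub hne hprime hp TpH HatH hle cMH))
    (hA : IsHomeomorph A.eHat) {H : Subgroup P} (TpH' : Subgroup Sf.chart.G)
    (HatH' : Subgroup (TemperedGraphGroupData.exists_completion_of_prop36 Sf.Gc h36 Sf.chart).choose)
    (hle' : TpH'.map (TemperedGraphGroupData.exists_completion_of_prop36 Sf.Gc h36
      Sf.chart).choose_spec.choose.toMonoidHom ≤ HatH')
    (cMH' : {x : X.Pt // X.IsCusp x} → Prop)
    (hH' : ((StableCurveTemperedData.ofSpecialFibre X d Sf h36 Sigma SigmaHat hsub hne hprime hp TpH' HatH' hle' cMH').graph.HatH :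
        Set (StableCurveTemperedData.ofSpecialFibre X d Sf h36 Sigma SigmaHat hsub hne hprime hp TpH' HatH' hle' cMH').graph.Hat) =
      closure ((StableCurveTemperedData.ofSpecialFibre X d Sf h36 Sigma SigmaHat hsub hne hprime hp TpH' HatH' hle' cMH').graph.ι ''
        (StableCurveTemperedData.ofSpecialFibre X d Sf h36 Sigma SigmaHat hsub hne hprime hp TpH' HatH' hle' cMH').graph.TpH))
    (hDic : ((W.deltaPmBox H).subgroupOf W.pmHat).map A.eHat.toMonoidHom =
      ((StableCurveTemperedData.ofSpecialFibre X d Sf h36 Sigma SigmaHat hsub hne hprime hp TpH' HatH' hle' cMH').deltaTpH.map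
        (StableCurveTemperedData.ofSpecialFibre X d Sf h36 Sigma SigmaHat hsub hne hprime hp TpH' HatH' hle' cMH').ιΔ).map
        (StableCurveTemperedData.ofSpecialFibre X d Sf h36 Sigma SigmaHat hsub hne hprime hp TpH' HatH' hle' cMH').DeltaHat.subtype)
    (h23v' : (StableCurveTemperedData.ofSpecialFibre X d Sf h36 Sigma SigmaHat hsub hne hprime hp TpH' HatH' hle' cMH').Cor23v) :
    ∀ γ' : W.Corhat, γ' ∈ W.piPM ⊓ W.aug.ker →
      γ' ∈ closure (W.deltaPmBox H : Set W.Corhat) → γ' ∈ W.deltaPmBox H :=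
  h23v (D := StableCurveTemperedData.ofSpecialFibre X d Sf h36 Sigma SigmaHat hsub hne hprime hp TpH' HatH' hle' cMH')
    { eHat := A.eHat, map_piPM := A.map_piPM, mem_ker_iff := A.mem_ker_iff, inertia_iff := A.inertia_iff }
    { deltaPmBox_eq := hDic, isHomeomorph := hA }
    (StableCurveTemperedData.cor23ii_ofSpecialFibre X d Sf h36 Sigma SigmaHat hsub hne hprime hp TpH' HatH' hle' cMH' hH') h23v'

/-- **[IUTchII] Cor 2.4 (i) (the landed predicate `Cor24_i W Cu H I`) at an agreement with a special-fibre datum**, for a `Π_v`-cuspidal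
`I ⊆ Δ̂^cor_v` and a subgroup `Π_{v□} ⊆ Π_v`: from input (A) (`inputA_ofSpecialFibre`: MODULO [IUTchI] Prop 2.4 (i) of the datum),
input (C) (`h23v_ofSpecialFibre`: MODULO a sub-graph `Π^tp_{ℍ'}` (with `Π̂_{ℍ'}` its closure) carrying the Δ-dictionary identity for `Π_{v□}`,
and [IUTchI] Cor 2.3 (v) of its datum), and the open-subgroup step (B) `h23vi` (GAP-LEDGER G-w4d012-2) — via this lineage's
`cor24_i_of_inputs` (p411807).  PROVED. ([IUTchII] Cor 2.4 (i), kurims pp.69–71) [claim: Mochizuki2012, status: disputed] -/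
theorem cor24_i_ofSpecialFibre (hfi : (W.piV.subgroupOf W.piPM).index ≠ 0)
    (hlev : ∀ (Q I : Subgroup W.Corhat), Cu.IsCuspidalInertia Q I ↔
      I ≤ Q ∧ ∃ I₀ : Subgroup W.Corhat, Cu.IsCuspidalInertia W.piPM I₀ ∧ I = I₀ ⊓ Q)
    (A : StableCurveAgreement W Cu
      (StableCurveTemperedData.ofSpecialFibre X d Sf h36 Sigma SigmaHat hsub hne hprime hp TpH HatH hle cMH))
    (hA : IsHomeomorph A.eHat)
    (h24i : (StableCurveTemperedData.ofSpecialFibre X d Sf h36 Sigma SigmaHat hsub hne hprime hp TpH HatH hle cMH).Prop24i)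
    {I : Subgroup W.Corhat} (hI : Cu.IsCuspidalInertia W.piV I) (hIker : I ≤ W.aug.ker)
    {H : Subgroup P} (TpH' : Subgroup Sf.chart.G)
    (HatH' : Subgroup (TemperedGraphGroupData.exists_completion_of_prop36 Sf.Gc h36 Sf.chart).choose)
    (hle' : TpH'.map (TemperedGraphGroupData.exists_completion_of_prop36 Sf.Gc h36
      Sf.chart).choose_spec.choose.toMonoidHom ≤ HatH')
    (cMH' : {x : X.Pt // X.IsCusp x} → Prop)
    (hH' : ((StableCurveTemperedData.ofSpecialFibre X d Sf h36 Sigma SigmaHat hsub hne hprime hp TpH' HatH' hle' cMH').graph.HatH :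
        Set (StableCurveTemperedData.ofSpecialFibre X d Sf h36 Sigma SigmaHat hsub hne hprime hp TpH' HatH' hle' cMH').graph.Hat) =
      closure ((StableCurveTemperedData.ofSpecialFibre X d Sf h36 Sigma SigmaHat hsub hne hprime hp TpH' HatH' hle' cMH').graph.ι ''
        (StableCurveTemperedData.ofSpecialFibre X d Sf h36 Sigma SigmaHat hsub hne hprime hp TpH' HatH' hle' cMH').graph.TpH))
    (hDic : ((W.deltaPmBox H).subgroupOf W.pmHat).map A.eHat.toMonoidHom =
      ((StableCurveTemperedData.ofSpecialFibre X d Sf h36 Sigma SigmaHat hsub hne hprime hp TpH' HatH' hle' cMH').deltaTpH.map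
        (StableCurveTemperedData.ofSpecialFibre X d Sf h36 Sigma SigmaHat hsub hne hprime hp TpH' HatH' hle' cMH').ιΔ).map
        (StableCurveTemperedData.ofSpecialFibre X d Sf h36 Sigma SigmaHat hsub hne hprime hp TpH' HatH' hle' cMH').DeltaHat.subtype)
    (h23v' : (StableCurveTemperedData.ofSpecialFibre X d Sf h36 Sigma SigmaHat hsub hne hprime hp TpH' HatH' hle' cMH').Cor23v)
    (h23vi : ∀ γ' : W.Corhat, γ' ∈ W.piPM ⊓ W.aug.ker →
      I.map (MulAut.conj γ').toMonoidHom ≤ W.pmBox H → γ' ∈ closure (W.deltaPmBox H : Set W.Corhat)) :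
    Literature.IUT.HodgeArakelov.Cor24_i W Cu H I :=
  cor24_i_of_inputs W Cu H I (A.inputA_ofSpecialFibre hfi hlev h24i hI hIker) h23vi
    (A.h23v_ofSpecialFibre hA TpH' HatH' hle' cMH' hH' hDic h23v')

end StableCurveAgreement

end PlusMinusTower

/-! ### §4. The decl of record `Cor24_i'` over the printed family `□ ∈ {▶} ∪ {•t}` -/

section Family

variable {S : BadPlaceSetting.{0}} {P : TopGroup.{0}} {T : TemperedCoverings S P}
  {D : EtaleThetaData S.toThetaSetting P} (Dec : SubgraphDecomposition S T D) (W : PlusMinusTower T)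
  (Cu : CuspidalInertiaData W) {L : LabCuspStructure Cu} (Ld : LabelledDecomposition Dec L)
  {p : ℕ} [Fact p.Prime] {X : TemperedCurve p} {d : X.GroupLevelData}
  {Sf : SpecialFibreData (X.toTemperedArithmeticGroup d)} {h36 : Sf.Gc.Prop36Hypotheses}
  {Sigma SigmaHat : Set ℕ} {hsub : Sigma ⊆ SigmaHat} {hne : Sigma.Nonempty}
  {hprime : ∀ q ∈ SigmaHat, q.Prime} {hp : p ∉ Sigma} {TpH : Subgroup Sf.chart.G}
  {HatH : Subgroup (TemperedGraphGroupData.exists_completion_of_prop36 Sf.Gc h36 Sf.chart).choose}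
  {hle : TpH.map (TemperedGraphGroupData.exists_completion_of_prop36 Sf.Gc h36
    Sf.chart).choose_spec.choose.toMonoidHom ≤ HatH}
  {cMH : {x : X.Pt // X.IsCusp x} → Prop}

/-- **[IUTchII] Cor 2.4 (i)′ (decl of record `Cor24_i'`) at an agreement with a special-fibre datum**, for a `Π_v`-cuspidal
`I ⊆ Δ̂^cor_v`: from [IUTchI] Prop 2.4 (i) of the datum (`h24i`); for EACH admissible `Π_{v□}` (`Cor24_family`) SOME sub-graph
`Π^tp_{ℍ'}` of the special fibre («`ℍ = Γ_□`», print p. 70) with `Π̂_{ℍ'}` its closure, the Δ-dictionary identity and [IUTchI] Cor 2.3 (v)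
of its datum (`Dic`); and the open-subgroup step (B) (`h23vi`, GAP-LEDGER G-w4d012-2).  The agreement's `hΛ`, input (A) modulo `Prop24i`,
and Cor 2.3 (ii) are DISCHARGED.  PROVED. ([IUTchII] Cor 2.4 (i), kurims pp.69–71) [claim: Mochizuki2012, status: disputed] -/
theorem cor24_i'_ofSpecialFibre (hfi : (W.piV.subgroupOf W.piPM).index ≠ 0)
    (hlev : ∀ (Q I : Subgroup W.Corhat), Cu.IsCuspidalInertia Q I ↔
      I ≤ Q ∧ ∃ I₀ : Subgroup W.Corhat, Cu.IsCuspidalInertia W.piPM I₀ ∧ I = I₀ ⊓ Q)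
    (A : W.StableCurveAgreement Cu
      (StableCurveTemperedData.ofSpecialFibre X d Sf h36 Sigma SigmaHat hsub hne hprime hp TpH HatH hle cMH))
    (hA : IsHomeomorph A.eHat)
    (h24i : (StableCurveTemperedData.ofSpecialFibre X d Sf h36 Sigma SigmaHat hsub hne hprime hp TpH HatH hle cMH).Prop24i)
    {I : Subgroup W.Corhat} (hI : Cu.IsCuspidalInertia W.piV I) (hIker : I ≤ W.aug.ker)
    (Dic : ∀ H : Subgroup P, Cor24_family Dec Ld H →
      ∃ (TpH' : Subgroup Sf.chart.G)
        (HatH' : Subgroup (TemperedGraphGroupData.exists_completion_of_prop36 Sf.Gc h36 Sf.chart).choose)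
        (hle' : TpH'.map (TemperedGraphGroupData.exists_completion_of_prop36 Sf.Gc h36
          Sf.chart).choose_spec.choose.toMonoidHom ≤ HatH')
        (cMH' : {x : X.Pt // X.IsCusp x} → Prop),
        ((StableCurveTemperedData.ofSpecialFibre X d Sf h36 Sigma SigmaHat hsub hne hprime hp TpH' HatH' hle' cMH').graph.HatH :
            Set (StableCurveTemperedData.ofSpecialFibre X d Sf h36 Sigma SigmaHat hsub hne hprime hp TpH' HatH' hle' cMH').graph.Hat) =
          closure ((StableCurveTemperedData.ofSpecialFibre X d Sf h36 Sigma SigmaHat hsub hne hprime hp TpH' HatH' hle' cMH').graph.ι ''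
            (StableCurveTemperedData.ofSpecialFibre X d Sf h36 Sigma SigmaHat hsub hne hprime hp TpH' HatH' hle' cMH').graph.TpH) ∧
        ((W.deltaPmBox H).subgroupOf W.pmHat).map A.eHat.toMonoidHom =
          ((StableCurveTemperedData.ofSpecialFibre X d Sf h36 Sigma SigmaHat hsub hne hprime hp TpH' HatH' hle' cMH').deltaTpH.map
            (StableCurveTemperedData.ofSpecialFibre X d Sf h36 Sigma SigmaHat hsub hne hprime hp TpH' HatH' hle' cMH').ιΔ).map
            (StableCurveTemperedData.ofSpecialFibre X d Sf h36 Sigma SigmaHat hsub hne hprime hp TpH' HatH' hle' cMH').DeltaHat.subtype ∧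
        (StableCurveTemperedData.ofSpecialFibre X d Sf h36 Sigma SigmaHat hsub hne hprime hp TpH' HatH' hle' cMH').Cor23v)
    (h23vi : ∀ H : Subgroup P, Cor24_family Dec Ld H →
      ∀ γ' : W.Corhat, γ' ∈ W.piPM ⊓ W.aug.ker →
        I.map (MulAut.conj γ').toMonoidHom ≤ W.pmBox H → γ' ∈ closure (W.deltaPmBox H : Set W.Corhat)) :
    Literature.IUT.HodgeArakelov.Cor24_i' Dec W Cu Ld I := by
  intro H hH
  obtain ⟨TpH', HatH', hle', cMH', hH', hDic, h23v'⟩ := Dic H hH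
  exact A.cor24_i_ofSpecialFibre hfi hlev hA h24i hI hIker TpH' HatH' hle' cMH' hH' hDic h23v' (h23vi H hH)

end Family

end Literature.IUT.HodgeArakelov

end
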